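import Mathlib.Analysis.Calculus.ContDiff.Operations
import Mathlib.Analysis.Calculus.MeanValue
import Mathlib.Analysis.Calculus.Deriv.Pi
import Mathlib.Data.Finset.Piecewise
import HarnessLib

/-!
# Coordinatewise smoothness: families closed under bounded coordinate partial derivatives are `C^∞`

Track Y2 (ROBUST-BALL), regularity lane «C-REG» / «C-JOINT», the finite-dimensional calculus tool behind the `k`-parameter joint
smoothness of the state map (rb-p1 g12).

On an open set `U ⊆ (ι → ℝ)` (`ι` finite; the sup norm, so balls are cubes and coordinate segments between points of a ball stay in the
ball) consider a family `𝓕` of real functions such that every `f ∈ 𝓕` has, along every coordinate `j`, a derivative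
`s ↦ f (update y j s)` at `y j` equal to `g y` for some `g ∈ 𝓕` (closure under coordinate partial derivatives), and every member is
bounded on `U`.  Then every member is `ContDiffOn ℝ ∞` on `U`, with Fréchet derivative `Σ_j (∂_j f)(x) • proj_j`.

Mechanism (elementary, no Mathlib bivariate bridge needed): bounded coordinate partials ⇒ Lipschitz along coordinate legs (1-D mean value
inequality) ⇒ Lipschitz on cubes by telescoping over `Finset.piecewise` paths ⇒ continuity; the same telescoping with the Lipschitz bound of
the partials gives the quadratic remainder estimate `|f z − f x − Σ_j ∂_j f(x)(z_j − x_j)| ≤ (Σ_j K_j)·‖z − x‖²`, i.e. `HasFDerivAt`; then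
induction on the order via `contDiffOn_succ_iff_fderiv_of_isOpen`.

Main statements: `abs_sub_update_sub_mul_le` (one coordinate leg with a linear corrector), `abs_sub_piecewise_le_of_partials`
(telescoping Lipschitz bound), `hasFDerivAt_of_lipschitz_partials`, ★ `contDiffOn_infty_of_coordinatewise_family` (set form),
`hasFDerivAt_of_coordinatewise_family`, `fderiv_apply_single_of_coordinatewise_family`, ★ `contDiffOn_infty_of_indexed_family`
(indexed form `∂_j T_w = c_{w,j} T_{D w j}` — the shape of the word-indexed response series of a `k`-parameter family, `c = −1`),
`fderiv_apply_single_of_indexed_family`.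

Honest framing: pure finite-dimensional calculus; the lattice content (Feynman–Hellmann formulas along coordinate lines of a
`k`-parameter affine family in the weighted ball) is supplied by the consumers.
-/

namespace Summit.Ventures.YMGap.RobustBall

open Set Filter Asymptotics
open scoped Topology ContDiff

section Calculus

variable {ι : Type*} [Fintype ι] [DecidableEq ι]

/-- Along a segment contained in `[[a, b]]`, a point `σ ∈ [[a, b]]` with both endpoints within `r` of `c` is within `r` of `c`. -/
theorem abs_sub_lt_of_mem_uIcc {a b c r σ : ℝ} (ha : |a - c| < r) (hb : |b - c| < r) (hσ : σ ∈ Set.uIcc a b) : |σ - c| < r := by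
  rcases Set.mem_uIcc.1 hσ with ⟨h1, h2⟩ | ⟨h1, h2⟩
  · rw [abs_lt] at ha hb ⊢; exact ⟨by linarith [ha.1], by linarith [hb.2]⟩
  · rw [abs_lt] at ha hb ⊢; exact ⟨by linarith [hb.1], by linarith [ha.2]⟩

omit [Fintype ι] in
/-- **One coordinate leg with a linear corrector.**  If `s ↦ f (update y j s)` has derivative `g y` at `y j` for every `y ∈ B`, the
coordinate segment `update p j σ`, `σ ∈ [[a, b]]`, lies in `B`, and `|g (update p j σ) − c| ≤ δ` on it, then
`|f (update p j b) − f (update p j a) − c (b − a)| ≤ δ |b − a|`. -/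
theorem abs_sub_update_sub_mul_le {f g : (ι → ℝ) → ℝ} {B : Set (ι → ℝ)} {j : ι} {p : ι → ℝ} {a b c δ : ℝ}
    (hseg : ∀ σ ∈ Set.uIcc a b, Function.update p j σ ∈ B)
    (hder : ∀ y ∈ B, HasDerivAt (fun s => f (Function.update y j s)) (g y) (y j))
    (hδ : ∀ σ ∈ Set.uIcc a b, |g (Function.update p j σ) - c| ≤ δ) :
    |f (Function.update p j b) - f (Function.update p j a) - c * (b - a)| ≤ δ * |b - a| := by
  have hG : ∀ σ ∈ Set.uIcc a b, HasDerivAt (fun s => f (Function.update p j s) - c * s) (g (Function.update p j σ) - c) σ := by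
    intro σ hσ
    have h := hder _ (hseg σ hσ)
    simp only [Function.update_idem, Function.update_self] at h
    exact h.sub ((hasDerivAt_id σ).const_mul c |>.congr_deriv (by simp))
  have h := Convex.norm_image_sub_le_of_norm_hasDerivWithin_le (f := fun s => f (Function.update p j s) - c * s)
    (f' := fun σ => g (Function.update p j σ) - c) (s := Set.uIcc a b) (fun σ hσ => (hG σ hσ).hasDerivWithinAt)
    (fun σ hσ => by rw [Real.norm_eq_abs]; exact hδ σ hσ) (convex_uIcc a b) Set.left_mem_uIcc Set.right_mem_uIcc
  simp only [Real.norm_eq_abs] at h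
  calc |f (Function.update p j b) - f (Function.update p j a) - c * (b - a)|
      = |f (Function.update p j b) - c * b - (f (Function.update p j a) - c * a)| := by congr 1; ring
    _ ≤ δ * |b - a| := h

/-- A `Finset.piecewise` mixture of two points of a sup-norm ball lies in the ball. -/
theorem piecewise_mem_ball {x y z : ι → ℝ} {r : ℝ} (hy : y ∈ Metric.ball x r) (hz : z ∈ Metric.ball x r) (s : Finset ι) :
    s.piecewise z y ∈ Metric.ball x r := by
  have hr : 0 < r := Metric.pos_of_mem_ball hy
  rw [Metric.mem_ball, dist_pi_lt_iff hr] at hy hz ⊢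
  intro i
  by_cases hi : i ∈ s
  · rw [Finset.piecewise_eq_of_mem _ _ _ hi]; exact hz i
  · rw [Finset.piecewise_eq_of_notMem _ _ _ hi]; exact hy i

/-- **Telescoping Lipschitz bound.**  Bounded coordinate partials on a sup-norm ball (`|∂_j f| ≤ C_j`) give, for `y, z` in the ball and every
set `s` of switched coordinates, `|f (s.piecewise z y) − f y| ≤ (Σ_{j ∈ s} C_j) · dist z y`. -/
theorem abs_sub_piecewise_le_of_partials {f : (ι → ℝ) → ℝ} {g : ι → (ι → ℝ) → ℝ} {x : ι → ℝ} {r : ℝ}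
    (hder : ∀ j, ∀ y ∈ Metric.ball x r, HasDerivAt (fun s => f (Function.update y j s)) (g j y) (y j))
    {C : ι → ℝ} (hC : ∀ j, ∀ y ∈ Metric.ball x r, |g j y| ≤ C j) {y z : ι → ℝ} (hy : y ∈ Metric.ball x r)
    (hz : z ∈ Metric.ball x r) (s : Finset ι) : |f (s.piecewise z y) - f y| ≤ (∑ j ∈ s, C j) * dist z y := by
  have hr : 0 < r := Metric.pos_of_mem_ball hy
  induction s using Finset.induction_on with
  | empty => simp
  | insert j s hj ih =>
    rw [Finset.piecewise_insert, Finset.sum_insert hj, add_mul]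
    set p : ι → ℝ := s.piecewise z y with hp
    have hpB : p ∈ Metric.ball x r := piecewise_mem_ball hy hz s
    have hpj : p j = y j := Finset.piecewise_eq_of_notMem _ _ _ hj
    -- the coordinate segment from `p` to `update p j (z j)` stays in the ball
    have hyj : |y j - x j| < r := by
      have h := (dist_pi_lt_iff hr).1 (Metric.mem_ball.1 hy) j; rwa [Real.dist_eq] at h
    have hzj : |z j - x j| < r := by
      have h := (dist_pi_lt_iff hr).1 (Metric.mem_ball.1 hz) j; rwa [Real.dist_eq] at h
    have hseg : ∀ σ ∈ Set.uIcc (p j) (z j), Function.update p j σ ∈ Metric.ball x r := by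
      intro σ hσ
      rw [hpj] at hσ
      rw [Metric.mem_ball, dist_pi_lt_iff hr]
      intro i
      by_cases hi : i = j
      · subst hi; rw [Function.update_self, Real.dist_eq]; exact abs_sub_lt_of_mem_uIcc hyj hzj hσ
      · rw [Function.update_of_ne hi]; exact (dist_pi_lt_iff hr).1 (Metric.mem_ball.1 hpB) i
    have hleg := abs_sub_update_sub_mul_le (c := 0) (δ := C j) hseg (hder j) (fun σ hσ => by rw [sub_zero]; exact hC j _ (hseg σ hσ))
    rw [Function.update_eq_self, zero_mul, sub_zero, hpj] at hleg
    have hdj : |z j - y j| ≤ dist z y := by rw [← Real.dist_eq]; exact dist_le_pi_dist z y j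
    have hCj : 0 ≤ C j := (abs_nonneg _).trans (hC j y hy)
    calc |f (Function.update p j (z j)) - f y| = |(f (Function.update p j (z j)) - f p) + (f p - f y)| := by ring_nf
      _ ≤ |f (Function.update p j (z j)) - f p| + |f p - f y| := abs_add_le _ _
      _ ≤ C j * |z j - y j| + (∑ i ∈ s, C i) * dist z y := add_le_add hleg ih
      _ ≤ C j * dist z y + (∑ i ∈ s, C i) * dist z y := by gcongr

/-- **Lipschitz on sup-norm balls from bounded coordinate partials**: `|f z − f y| ≤ (Σ_j C_j) · dist z y` on the ball. -/
theorem abs_sub_le_of_partials {f : (ι → ℝ) → ℝ} {g : ι → (ι → ℝ) → ℝ} {x : ι → ℝ} {r : ℝ}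
    (hder : ∀ j, ∀ y ∈ Metric.ball x r, HasDerivAt (fun s => f (Function.update y j s)) (g j y) (y j))
    {C : ι → ℝ} (hC : ∀ j, ∀ y ∈ Metric.ball x r, |g j y| ≤ C j) {y z : ι → ℝ} (hy : y ∈ Metric.ball x r)
    (hz : z ∈ Metric.ball x r) : |f z - f y| ≤ (∑ j, C j) * dist z y := by
  have h := abs_sub_piecewise_le_of_partials hder hC hy hz Finset.univ
  rwa [Finset.piecewise_univ] at h

/-- **Fréchet differentiability from Lipschitz coordinate partials.**  If on a sup-norm ball around `x` the coordinate partials `g_j` of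
`f` exist and are Lipschitz (`|g_j y − g_j z| ≤ K_j dist y z`, `K_j ≥ 0`), then the quadratic remainder bound
`|f z − f x − Σ_j g_j(x)(z_j − x_j)| ≤ (Σ_j K_j) · (dist z x)²` holds on the ball and `HasFDerivAt f (Σ_j g_j(x) • proj_j) x`. -/
theorem hasFDerivAt_of_lipschitz_partials {f : (ι → ℝ) → ℝ} {g : ι → (ι → ℝ) → ℝ} {x : ι → ℝ} {r : ℝ} (hr : 0 < r)
    (hder : ∀ j, ∀ y ∈ Metric.ball x r, HasDerivAt (fun s => f (Function.update y j s)) (g j y) (y j))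
    {K : ι → ℝ} (hK0 : ∀ j, 0 ≤ K j)
    (hK : ∀ j, ∀ y ∈ Metric.ball x r, ∀ z ∈ Metric.ball x r, |g j y - g j z| ≤ K j * dist y z) :
    (∀ z ∈ Metric.ball x r, |f z - f x - ∑ j, g j x * (z j - x j)| ≤ (∑ j, K j) * dist z x * dist z x) ∧
    HasFDerivAt f (∑ j, g j x • (ContinuousLinearMap.proj j : (ι → ℝ) →L[ℝ] ℝ)) x := by
  have hx : x ∈ Metric.ball x r := Metric.mem_ball_self hr
  -- telescoping remainder estimate
  have hrem : ∀ z ∈ Metric.ball x r, ∀ s : Finset ι,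
      |f (s.piecewise z x) - f x - ∑ j ∈ s, g j x * (z j - x j)| ≤ (∑ j ∈ s, K j) * dist z x * dist z x := by
    intro z hz s
    induction s using Finset.induction_on with
    | empty => simp
    | insert j s hj ih =>
      rw [Finset.piecewise_insert, Finset.sum_insert hj, Finset.sum_insert hj, add_mul, add_mul]
      set p : ι → ℝ := s.piecewise z x with hp
      have hpj : p j = x j := Finset.piecewise_eq_of_notMem _ _ _ hj
      -- the segment from `p` to `update p j (z j)` stays within `dist z x` of `x`
      have hsegle : ∀ σ ∈ Set.uIcc (p j) (z j), dist (Function.update p j σ) x ≤ dist z x := by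
        intro σ hσ
        rw [hpj] at hσ
        refine (dist_pi_le_iff dist_nonneg).2 fun i => ?_
        by_cases hi : i = j
        · subst hi
          rw [Function.update_self, Real.dist_eq]
          exact (abs_sub_left_of_mem_uIcc hσ).trans (by rw [← Real.dist_eq]; exact dist_le_pi_dist z x i)
        · rw [Function.update_of_ne hi, hp]
          by_cases his : i ∈ s
          · rw [Finset.piecewise_eq_of_mem _ _ _ his]; exact dist_le_pi_dist z x i
          · rw [Finset.piecewise_eq_of_notMem _ _ _ his, dist_self]; exact dist_nonneg
      have hseg : ∀ σ ∈ Set.uIcc (p j) (z j), Function.update p j σ ∈ Metric.ball x r := fun σ hσ =>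
        Metric.mem_ball.2 ((hsegle σ hσ).trans_lt (Metric.mem_ball.1 hz))
      have hleg := abs_sub_update_sub_mul_le (c := g j x) (δ := K j * dist z x) hseg (hder j) (fun σ hσ =>
        (hK j _ (hseg σ hσ) x hx).trans (mul_le_mul_of_nonneg_left (hsegle σ hσ) (hK0 j)))
      rw [Function.update_eq_self, hpj] at hleg
      have hdj : |z j - x j| ≤ dist z x := by rw [← Real.dist_eq]; exact dist_le_pi_dist z x j
      have hKd : 0 ≤ K j * dist z x := mul_nonneg (hK0 j) dist_nonneg
      calc |f (Function.update p j (z j)) - f x - (g j x * (z j - x j) + ∑ i ∈ s, g i x * (z i - x i))|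
          = |(f (Function.update p j (z j)) - f p - g j x * (z j - x j)) + (f p - f x - ∑ i ∈ s, g i x * (z i - x i))| := by
            ring_nf
        _ ≤ |f (Function.update p j (z j)) - f p - g j x * (z j - x j)| + |f p - f x - ∑ i ∈ s, g i x * (z i - x i)| :=
            abs_add_le _ _
        _ ≤ K j * dist z x * |z j - x j| + (∑ i ∈ s, K i) * dist z x * dist z x := add_le_add hleg ih
        _ ≤ K j * dist z x * dist z x + (∑ i ∈ s, K i) * dist z x * dist z x := by gcongr
  have hrem' : ∀ z ∈ Metric.ball x r, |f z - f x - ∑ j, g j x * (z j - x j)| ≤ (∑ j, K j) * dist z x * dist z x := by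
    intro z hz
    have h := hrem z hz Finset.univ
    rwa [Finset.piecewise_univ] at h
  refine ⟨hrem', ?_⟩
  -- the little-o statement
  set L : (ι → ℝ) →L[ℝ] ℝ := ∑ j, g j x • (ContinuousLinearMap.proj j : (ι → ℝ) →L[ℝ] ℝ) with hL
  have hLapply : ∀ h : ι → ℝ, L h = ∑ j, g j x * h j := by
    intro h
    simp only [hL, _root_.sum_apply, _root_.smul_apply, ContinuousLinearMap.proj_apply, smul_eq_mul]
  rw [hasFDerivAt_iff_isLittleO, Asymptotics.isLittleO_iff]
  intro c hc
  set SK : ℝ := ∑ j, K j with hSK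
  have hSK0 : 0 ≤ SK := Finset.sum_nonneg fun j _ => hK0 j
  have hρ : 0 < min r (c / (SK + 1)) := lt_min hr (div_pos hc (by linarith))
  filter_upwards [Metric.ball_mem_nhds x hρ] with z hz
  have hzr : z ∈ Metric.ball x r := Metric.ball_subset_ball (min_le_left _ _) hz
  have hzc : dist z x < c / (SK + 1) := (Metric.mem_ball.1 hz).trans_le (min_le_right _ _)
  rw [Real.norm_eq_abs, hLapply, ← dist_eq_norm]
  simp only [Pi.sub_apply]
  calc |f z - f x - ∑ j, g j x * (z j - x j)| ≤ SK * dist z x * dist z x := hrem' z hzr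
    _ ≤ SK * (c / (SK + 1)) * dist z x := by gcongr
    _ ≤ c * dist z x := by
        apply mul_le_mul_of_nonneg_right _ dist_nonneg
        rw [mul_div_assoc']
        rw [div_le_iff₀ (by linarith)]
        nlinarith

/-- ★ **A FAMILY CLOSED UNDER BOUNDED COORDINATE PARTIAL DERIVATIVES IS `C^∞`.**  `U ⊆ (ι → ℝ)` open (`ι` finite), `𝓕` a set of real
functions such that every `f ∈ 𝓕` has along every coordinate `j` a derivative `∂_j f = g ∈ 𝓕` on `U`
(`HasDerivAt (s ↦ f (update y j s)) (g y) (y j)` for `y ∈ U`) and every member of `𝓕` is bounded on `U`.  Then every `f ∈ 𝓕` is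
`ContDiffOn ℝ ∞` on `U`. -/
theorem contDiffOn_infty_of_coordinatewise_family (𝓕 : Set ((ι → ℝ) → ℝ)) {U : Set (ι → ℝ)} (hU : IsOpen U)
    (hder : ∀ f ∈ 𝓕, ∀ j : ι, ∃ g ∈ 𝓕, ∀ y ∈ U, HasDerivAt (fun s => f (Function.update y j s)) (g y) (y j))
    (hbdd : ∀ f ∈ 𝓕, ∃ C, ∀ y ∈ U, |f y| ≤ C) : ∀ f ∈ 𝓕, ContDiffOn ℝ ∞ f U := by
  choose! G hG𝓕 hG using hder
  choose! C hC using hbdd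
  -- Lipschitz on every ball inside `U`
  have hlip : ∀ f ∈ 𝓕, ∀ x r, Metric.ball x r ⊆ U → ∀ y ∈ Metric.ball x r, ∀ z ∈ Metric.ball x r,
      |f y - f z| ≤ (∑ j, C (G f j)) * dist y z := by
    intro f hf x r hrU y hy z hz
    exact abs_sub_le_of_partials (fun j y hy => hG f hf j y (hrU hy)) (fun j y hy => hC (G f j) (hG𝓕 f hf j) y (hrU hy)) hz hy
  -- balls inside `U`
  have hball : ∀ x ∈ U, ∃ r, 0 < r ∧ Metric.ball x r ⊆ U := fun x hx => Metric.isOpen_iff.1 hU x hx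
  -- continuity
  have hcont : ∀ f ∈ 𝓕, ContinuousOn f U := by
    intro f hf x hx
    obtain ⟨r, hr, hrU⟩ := hball x hx
    refine (continuousAt_of_locally_lipschitz hr (∑ j, C (G f j)) fun y hy => ?_).continuousWithinAt
    rw [Real.dist_eq]
    exact hlip f hf x r hrU y hy x (Metric.mem_ball_self hr)
  -- Fréchet derivative
  have hfd : ∀ f ∈ 𝓕, ∀ x ∈ U, HasFDerivAt f (∑ j, G f j x • (ContinuousLinearMap.proj j : (ι → ℝ) →L[ℝ] ℝ)) x := by
    intro f hf x hx
    obtain ⟨r, hr, hrU⟩ := hball x hx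
    have hC0 : ∀ h ∈ 𝓕, 0 ≤ C h := fun h hh => (abs_nonneg _).trans (hC h hh x hx)
    exact (hasFDerivAt_of_lipschitz_partials hr (fun j y hy => hG f hf j y (hrU hy))
      (K := fun j => ∑ i, C (G (G f j) i)) (fun j => Finset.sum_nonneg fun i _ => hC0 _ (hG𝓕 _ (hG𝓕 f hf j) i))
      (fun j y hy z hz => hlip (G f j) (hG𝓕 f hf j) x r hrU y hy z hz)).2
  -- induction on the order, simultaneously for all members
  have hall : ∀ (n : ℕ), ∀ f ∈ 𝓕, ContDiffOn ℝ n f U := by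
    intro n
    induction n with
    | zero => intro f hf; exact contDiffOn_zero.2 (hcont f hf)
    | succ n ih =>
      intro f hf
      rw [show ((n + 1 : ℕ) : WithTop ℕ∞) = (n : WithTop ℕ∞) + 1 by push_cast; rfl, contDiffOn_succ_iff_fderiv_of_isOpen hU]
      refine ⟨fun x hx => (hfd f hf x hx).differentiableAt.differentiableWithinAt, fun h => absurd h (by simp), ?_⟩
      have hD : ContDiffOn ℝ n (fun x => ∑ j, G f j x • (ContinuousLinearMap.proj j : (ι → ℝ) →L[ℝ] ℝ)) U :=
        ContDiffOn.sum fun j _ => (ih (G f j) (hG𝓕 f hf j)).smul contDiffOn_const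
      exact hD.congr fun x hx => (hfd f hf x hx).fderiv
  intro f hf
  exact contDiffOn_infty.2 fun n => hall n f hf

/-- **The Fréchet derivative of a member**: under the hypotheses of `contDiffOn_infty_of_coordinatewise_family`, if `g_j ∈ 𝓕` are
coordinate partials on `U` of a function `f` (a member or not) then `HasFDerivAt f (Σ_j g_j(x) • proj_j) x` at every `x ∈ U`. -/
theorem hasFDerivAt_of_coordinatewise_family (𝓕 : Set ((ι → ℝ) → ℝ)) {U : Set (ι → ℝ)} (hU : IsOpen U)
    (hder : ∀ f ∈ 𝓕, ∀ j : ι, ∃ g ∈ 𝓕, ∀ y ∈ U, HasDerivAt (fun s => f (Function.update y j s)) (g y) (y j))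
    (hbdd : ∀ f ∈ 𝓕, ∃ C, ∀ y ∈ U, |f y| ≤ C) {f : (ι → ℝ) → ℝ} {g : ι → (ι → ℝ) → ℝ} (hg : ∀ j, g j ∈ 𝓕)
    (hfg : ∀ j, ∀ y ∈ U, HasDerivAt (fun s => f (Function.update y j s)) (g j y) (y j)) {x : ι → ℝ} (hx : x ∈ U) :
    HasFDerivAt f (∑ j, g j x • (ContinuousLinearMap.proj j : (ι → ℝ) →L[ℝ] ℝ)) x := by
  choose! G hG𝓕 hG using hder
  choose! C hC using hbdd
  have hlip : ∀ f ∈ 𝓕, ∀ x r, Metric.ball x r ⊆ U → ∀ y ∈ Metric.ball x r, ∀ z ∈ Metric.ball x r,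
      |f y - f z| ≤ (∑ j, C (G f j)) * dist y z := by
    intro f hf x r hrU y hy z hz
    exact abs_sub_le_of_partials (fun j y hy => hG f hf j y (hrU hy)) (fun j y hy => hC (G f j) (hG𝓕 f hf j) y (hrU hy)) hz hy
  obtain ⟨r, hr, hrU⟩ := Metric.isOpen_iff.1 hU x hx
  have hC0 : ∀ h ∈ 𝓕, 0 ≤ C h := fun h hh => (abs_nonneg _).trans (hC h hh x hx)
  exact (hasFDerivAt_of_lipschitz_partials hr (fun j y hy => hfg j y (hrU hy)) (K := fun j => ∑ i, C (G (g j) i))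
    (fun j => Finset.sum_nonneg fun i _ => hC0 _ (hG𝓕 _ (hg j) i)) (fun j y hy z hz => hlip (g j) (hg j) x r hrU y hy z hz)).2

/-- **Partial derivatives of a member**: with `g_j` as above, `fderiv ℝ f x (Pi.single j 1) = g_j x`, i.e. the `j`-th partial derivative
of `f` at `x ∈ U` is `g_j x`. -/
theorem fderiv_apply_single_of_coordinatewise_family (𝓕 : Set ((ι → ℝ) → ℝ)) {U : Set (ι → ℝ)} (hU : IsOpen U)
    (hder : ∀ f ∈ 𝓕, ∀ j : ι, ∃ g ∈ 𝓕, ∀ y ∈ U, HasDerivAt (fun s => f (Function.update y j s)) (g y) (y j))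
    (hbdd : ∀ f ∈ 𝓕, ∃ C, ∀ y ∈ U, |f y| ≤ C) {f : (ι → ℝ) → ℝ} {g : ι → (ι → ℝ) → ℝ} (hg : ∀ j, g j ∈ 𝓕)
    (hfg : ∀ j, ∀ y ∈ U, HasDerivAt (fun s => f (Function.update y j s)) (g j y) (y j)) {x : ι → ℝ} (hx : x ∈ U) (j : ι) :
    fderiv ℝ f x (Pi.single j 1) = g j x := by
  rw [(hasFDerivAt_of_coordinatewise_family 𝓕 hU hder hbdd hg hfg hx).fderiv]
  simp only [_root_.sum_apply, _root_.smul_apply, ContinuousLinearMap.proj_apply, smul_eq_mul,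
    Pi.single_apply, mul_ite, mul_one, mul_zero]
  simp [Finset.sum_ite_eq']

/-- ★ **INDEXED FORM (the shape consumers use): a family `T_w`, `w : W`, whose coordinate partials are fixed multiples of members,
`∂_j T_w = c_{w,j} · T_{D w j}` on an open `U`, with every `T_w` bounded on `U`, consists of `C^∞` functions**, and
`HasFDerivAt (T w) (Σ_j (c_{w,j} T_{D w j}(x)) • proj_j) x` on `U`.  (Apply the set version to the scalar multiples `a · T_w`.) -/
theorem contDiffOn_infty_of_indexed_family {W : Type*} (T : W → (ι → ℝ) → ℝ) (D : W → ι → W) (c : W → ι → ℝ) {U : Set (ι → ℝ)}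
    (hU : IsOpen U) (hder : ∀ w j, ∀ y ∈ U, HasDerivAt (fun s => T w (Function.update y j s)) (c w j * T (D w j) y) (y j))
    (hbdd : ∀ w, ∃ C, ∀ y ∈ U, |T w y| ≤ C) (w : W) :
    ContDiffOn ℝ ∞ (T w) U ∧
      ∀ x ∈ U, HasFDerivAt (T w) (∑ j, (c w j * T (D w j) x) • (ContinuousLinearMap.proj j : (ι → ℝ) →L[ℝ] ℝ)) x := by
  set 𝓕 : Set ((ι → ℝ) → ℝ) := {f | ∃ (w : W) (a : ℝ), f = fun y => a * T w y} with h𝓕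
  have hmem : ∀ (w : W) (a : ℝ), (fun y => a * T w y) ∈ 𝓕 := fun w a => ⟨w, a, rfl⟩
  have hder' : ∀ f ∈ 𝓕, ∀ j : ι, ∃ g ∈ 𝓕, ∀ y ∈ U, HasDerivAt (fun s => f (Function.update y j s)) (g y) (y j) := by
    rintro f ⟨w, a, rfl⟩ j
    refine ⟨fun y => (a * c w j) * T (D w j) y, hmem (D w j) (a * c w j), fun y hy => ?_⟩
    have h := (hder w j y hy).const_mul a
    simpa only [mul_assoc] using h
  have hbdd' : ∀ f ∈ 𝓕, ∃ C, ∀ y ∈ U, |f y| ≤ C := by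
    rintro f ⟨w, a, rfl⟩
    obtain ⟨C, hC⟩ := hbdd w
    exact ⟨|a| * C, fun y hy => by rw [abs_mul]; exact mul_le_mul_of_nonneg_left (hC y hy) (abs_nonneg a)⟩
  have hTw : T w = fun y => 1 * T w y := funext fun y => (one_mul _).symm
  refine ⟨?_, fun x hx => ?_⟩
  · rw [hTw]; exact contDiffOn_infty_of_coordinatewise_family 𝓕 hU hder' hbdd' _ (hmem w 1)
  · exact hasFDerivAt_of_coordinatewise_family 𝓕 hU hder' hbdd' (f := T w) (g := fun j y => c w j * T (D w j) y)
      (fun j => hmem (D w j) (c w j)) (fun j y hy => hder w j y hy) hx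

/-- **Partial derivatives in the indexed form**: `fderiv ℝ (T w) x (Pi.single j 1) = c_{w,j} · T_{D w j}(x)` at every `x ∈ U`. -/
theorem fderiv_apply_single_of_indexed_family {W : Type*} (T : W → (ι → ℝ) → ℝ) (D : W → ι → W) (c : W → ι → ℝ)
    {U : Set (ι → ℝ)} (hU : IsOpen U)
    (hder : ∀ w j, ∀ y ∈ U, HasDerivAt (fun s => T w (Function.update y j s)) (c w j * T (D w j) y) (y j))
    (hbdd : ∀ w, ∃ C, ∀ y ∈ U, |T w y| ≤ C) (w : W) {x : ι → ℝ} (hx : x ∈ U) (j : ι) :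
    fderiv ℝ (T w) x (Pi.single j 1) = c w j * T (D w j) x := by
  rw [((contDiffOn_infty_of_indexed_family T D c hU hder hbdd w).2 x hx).fderiv]
  simp only [_root_.sum_apply, _root_.smul_apply, ContinuousLinearMap.proj_apply, smul_eq_mul,
    Pi.single_apply, mul_ite, mul_one, mul_zero]
  simp [Finset.sum_ite_eq']

end Calculus

end Summit.Ventures.YMGap.RobustBall
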